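import Summits.CriticalPhenomena.SAWScalingLimit.Theorems.SAWRenewalTightnessTubeLowerBoundQuadrantCut
import Summits.CriticalPhenomena.SAWScalingLimit.Theorems.SAWRenewalTightnessTubeLowerBoundCornerFloorOfCut
import Summits.CriticalPhenomena.SAWScalingLimit.Theorems.SAWRenewalTightnessTubeLowerBoundHalfPlaneCut
import Summits.CriticalPhenomena.SAWScalingLimit.Theorems.SAWRenewalTightnessTubeLowerBoundSpanFloorOfHalfPlaneCut
import Summits.CriticalPhenomena.SAWScalingLimit.Theorems.SAWRenewalTightnessTubeLowerBoundSteeredChain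
import Summits.CriticalPhenomena.SAWScalingLimit.Theorems.SAWRenewalTightnessTubeLowerBoundMirrorPin
import Summits.CriticalPhenomena.SAWScalingLimit.Theorems.SAWRenewalTightnessTubeLowerBoundCornerStaircase
import Summits.CriticalPhenomena.SAWScalingLimit.Theorems.SAWRenewalTightnessTubeLowerBoundOctantReduction

/-!
# Crux `SAWRenewalTightness.TubeLowerBound` (stmt-CriticalPhenomena-4730): the two doors of the line `profile-potential`

Kernel-checked glue (no `sorry`, no new object) assembling the landed stubs of the round-2 line `profile-potential`
(lead a1, `prover-line-stmt-CriticalPhenomena-4730-a1-0`, 2026-08-16) into the two CONDITIONAL closures the line was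
built for — the fifth docking point of the crux next to the count ceiling (`LassoRepair.TubeLowerBound_of_countCeiling`
/ `…_of_enumerationExponentConjecture2D`, p113604) and the three boundary-started floors (F1) `CornerCrossingFloor`,
(F2) `stub_wedgeSlabFloor`, (F3) `ConeBridgeFloor`, and the first whose floor side is a QUALITATIVE divergence:

* `cornerCrossingFloor_of_quadrantProfile : QuadrantDivergence → QuadrantProfileBound → CornerCrossingFloor`
  (S4 `stub_cornerFloor_of_cut` p130961 fed with S1 `stub_quadrantCut` p131072);
* **`TubeLowerBound_of_quadrantProfile : QuadrantDivergence → QuadrantProfileBound → TubeLowerBound`** — the crux BY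
  NAME from the divergence of the critical corner susceptibility of the quadrant (S2, open, conjecture-grade) and the
  susceptibility-profile ratio ceiling (S3, open, conjecture-grade), through the landed `lieb-simon-star` chain
  `stub_steeredChain → stub_mirrorPin → stub_cornerStaircase → stub_octantReduction → tightTubeFloor_iff_crux`;
* `TubeLowerBound_of_countProfile : QuadrantDivergence → CountProfileBound → TubeLowerBound` (the fugacity-free count
  form of S3 is an admissible replacement, `quadrantProfileBound_of_count`, Defs p130472);
* **`spanRenewalFloor_of_halfPlaneProfile : SlabSubcritical → HalfPlaneProfileBound → SpanRenewalFloor`** — Kesten's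
  span-renewal floor (vertex form, the common milestone of the round-1 lines) from ONE half-plane ratio ceiling plus the
  classical slab subcriticality (S6 `stub_spanFloor_of_halfPlaneCut` p131154 fed with S5 `stub_halfPlaneCut` p130821;
  the divergence input is the tree's `AnnularMassDecay.Negative.halfPlanePartialSum_unbounded`).

The two remaining inputs `QuadrantDivergence` (S2) and `QuadrantProfileBound` (S3) are statements about corner-started
self-avoiding walks in the quadrant of `ℤ²` at `x_c` for which neither print nor the tree has a technique (triage r2-1,
r2-2; lead a1's census: S2 reduces, via the tree's Kesten identity and the `y ↦ −y` symmetry of irreducible bridges, exactly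
to `E_Kesten[T] = ∞` for the first irreducible piece dipping below the start row — a heavy-tail comparison of corner type).
Registered sub-goal of stmt-CriticalPhenomena-4730 proved here by name: `TubeLowerBound_of_quadrantProfile`.
-/

noncomputable section

namespace Summit.CriticalPhenomena.SAWScalingLimit.Theorems.TubeLowerBound.ProfilePotential

open Summit.CriticalPhenomena.SAWScalingLimit.Theses.SAWRenewalTightness (TubeLowerBound)
open Summit.CriticalPhenomena.SAWScalingLimit.Theorems.TubeLowerBound.LiebSimonStar

/-- **`CornerCrossingFloor` from the two quadrant inputs** (the single open stub of the landed line `lieb-simon-star`,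
with `K = 1`): the quadrant cut (S1, landed) summed at `x_c`, divided by the divergent corner partial sums (S2) using the
profile ratio ceiling (S3) — S4, landed. -/
theorem cornerCrossingFloor_of_quadrantProfile :
    QuadrantDivergence → QuadrantProfileBound → CornerCrossingFloor :=
  stub_cornerFloor_of_cut stub_quadrantCut

/-- **The crux from the line `profile-potential`, conditionally on its two open inputs**:
`QuadrantDivergence → QuadrantProfileBound → TubeLowerBound`, by `cornerCrossingFloor_of_quadrantProfile` and the landed
`lieb-simon-star` chain `stub_steeredChain → stub_mirrorPin → stub_cornerStaircase → stub_octantReduction`, closed by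
`tightTubeFloor_iff_crux` (Defs p76932).  (Registered sub-goal `TubeLowerBound_of_quadrantProfile`.) -/
theorem TubeLowerBound_of_quadrantProfile : QuadrantDivergence → QuadrantProfileBound → TubeLowerBound :=
  fun hdiv hprof => tightTubeFloor_iff_crux.1 (stub_octantReduction (stub_cornerStaircase (stub_mirrorPin
    (stub_steeredChain (cornerCrossingFloor_of_quadrantProfile hdiv hprof)))))

/-- **The crux from the divergence and the COUNT form of the profile bound** (`CountProfileBound`, fugacity-free:
`q^{(R+1)}_n ≤ A (R+2)^C q_n` for `n ≥ n₀(R)`), via the landed upgrade `quadrantProfileBound_of_count`. -/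
theorem TubeLowerBound_of_countProfile : QuadrantDivergence → CountProfileBound → TubeLowerBound :=
  fun hdiv hcount => TubeLowerBound_of_quadrantProfile hdiv (quadrantProfileBound_of_count hdiv hcount)

/-- **The by-product door**: Kesten's span-renewal floor `SpanRenewalFloor` (the `x_c`-mass of bridges of span
exactly `L` is `≥ c L^{−C}`, some partial sum, every `L ≥ 1`) from slab subcriticality (classical; Madras–Slade 1993
Thm 7.2.3 / (8.2.11), not yet in the tree for axis slabs) and ONE half-plane ratio ceiling `HalfPlaneProfileBound`
(open) — the half-plane cut S5 and the glue S6, both landed. -/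
theorem spanRenewalFloor_of_halfPlaneProfile : SlabSubcritical → HalfPlaneProfileBound → SpanRenewalFloor :=
  stub_spanFloor_of_halfPlaneCut stub_halfPlaneCut

end Summit.CriticalPhenomena.SAWScalingLimit.Theorems.TubeLowerBound.ProfilePotential

end
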